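import Literature.MathematicalPhysics.QuantumFieldTheory.Balaban1983to89.B9Eq316AveragingTransposeZdPrinted
import Literature.MathematicalPhysics.QuantumFieldTheory.Balaban1983to89.B8TowerBondsNonempty

/-!
# [B8] (1.31) ∕ [B6] (2.1)–(2.3) AT THE CUBE MEMBER OF (1.131): THE AVERAGING-BINDER CLASS LAWS, BY NAME — `LevelSepPP … (cubeLamBP' …) 1`
# («box ⊂ □_{j−1}, collar 1», print's split class; also for the TRUNCATED class map, at EVERY `m`) and `LevelSepP … (cubeLamB …) 1`
# («box ⊂ □_j, collar 1», the typed inner class) — lattice geometry of the cube tower `{□_j}`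

Cell `pub-ymgap`, seat `pub-ymgap-dag-n05-c` generation 14 (R134 N05 [B8] s1; trigger: dag-n06-b g17 DECL-DELTA-2, bus 2026-08-28 02:07Z, «the
law at the cube class is dag-n05-c's to derive»; dag-lead g15 DEDUP-372 GO 02:23Z; dag-n06-b WORD 02:21Z: truncated class map).  `--supports
stmt-QuantumFields-20542` (Literature lane; theorems only, nothing re-declared).
[B8] = [Balaban1985RegularSpaces]; [B6] = [Balaban1984PropagatorsII]; [4] = [Balaban1985BackgroundPropagators]; [3] = [Balaban1985Averaging].

WHY.  dag-n06-b's genuineness editions of the [4]-averaging binder — `B9Eq316AveragingTransposeZd.avgAtP_withQQ` (v1.0) and edition P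
`B9Eq316AveragingTransposeZdPrinted.avgAtP_withQQP ∕ avgAtγ_withQQP` (p596576, IN TREE) — prove the averaging letter for the GENUINE operator `Q*aQ`
under a DISPLAYED class law: `LevelSepP L m Ω ΛbP s` — «every site `y` of the box `Bʲ(c₋) ∪ Bʲ(c₊)` of a level-`j` class bond `c` lies in `Ω_j`, and a
unit-lattice bond at `y` touches `Ω_{i'}` (`i' ≤ m`) only for `i' ≤ j + s`» — resp. edition P's `LevelSepPP` (the same with `Ω_{j−1}`: by (1.31) the
CROSSING bonds of `Λ_j` have their box in `Ω_{j−1}` only).  The law is «the law owners' to derive for their class».  At the cube member of (1.131)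
(`Ω_j = □_j = cubeFam false L a M ρ k j`; classes: this seat's inner class `cubeLamB` and print's class `cubeLamBP`, dag-n05-e's SPLIT class
`cubeLamBP'` = `cubeLamB` at level `0`, `cubeLamBP` at the levels `j ≥ 1`) the owner is this seat.  THIS FILE derives both laws with the collar
constant `s = 1`, at every truncation `m ≤ k`, from the cube tower's geometry alone:
 (i) CLAUSE 1 — the box of a level-`j` bond of the split class lies in `□_{j−1}` (`B8Ineq159FlatCubeMemberPrinted.cubeLamBP_box_subset_pred` BY
     NAME at `j ≥ 1`; the inner class's defining box law «box ⊂ □₀» at `j = 0`);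
 (ii) CLAUSE 2 — for `j < m` the box sites AVOID `□_{j+1}` («`□_{j+1}` is a sum of the big blocks», p. 98: a level-`j` block meeting `□_{j+1}` is a
     block of `□_{j+1}^{(j)}`, and NEITHER end of a class bond below the truncation level is a site of `□_{j+1}^{(j)}` — (1.31) ∕ [B6] (2.3) ∕ (1.68));
     so a unit bond at a box site touches `□_{i'}`, `i' ≥ j + 1`, only through its far end, which the collar `ρ·L^{j+1} ≥ 1` between `∂□_{j+1}` and
     `□_{j+2}` keeps out of `□_{j+2}`: `i' ≤ j + 1`.  At `j = m` clause 2 is `i' ≤ m ≤ m + 1`.  (`s = 0` is FALSE: a box site on the outer layer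
     of `∂□_{j+1}` has its neighbour in `□_{j+1}`.)
ABOVE THE TOWER (`m > k`) the law is FALSE AS TYPED at the cube classes (§5: at the junk levels `j > k` the class is the non-empty `ρ`-collar ring of
`[a − ρ, a + M − 1 + ρ]^d` while `Ω_{j−1} = ∅`); the zero-churn cure (dag-n06-b WORD 02:21Z) is on the CLASS MAP: the TRUNCATED map «`cubeLamBP'` at
`m ≤ k`, `∅` above» obeys the law at EVERY `m` (vacuously above `k`), so `avgAtγ_withQQP` feeds the unguarded family binder
`havg : ∀ M j m, AvgAtγ …` of `B9SupplySockB9P3ZdGamma.sockB9P3D4γ_allLevels_of_thm33_on` with `ops := withQQP τ L ΛbT ops₀` and NO binder-family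
edition; the sockets concluded at `m ≤ (ι j).k` read the truncated map as `cubeLamBP' … m` (`if_pos`).  §4 states the law for the truncated map in
both spellings a consumer may write and for any sub-class map truncated above `k`.

CONTENTS.  §1 block geometry: `inBox_inner_of_mem_cube_succ_of_under` (a level-`j` block meeting `□_{j+1}` is a block of `□_{j+1}^{(j)}`),
`mem_cube_of_add_unit_mem_cube_succ` (the collar step).  §2 the split class: `not_inBox_inner_of_mem_cubeLamBP'`, ★ `not_mem_cube_succ_of_mem_box_cubeLamBP'`,
`cubeLamB_subset_cubeLamBP'`, `box_mem_pred_of_mem_cubeLamBP'` (clause 1), ★ `le_succ_of_bondTouches_box_cubeLamBP'` (clause 2), ★ `levelSepPP_body_cubeLamBP'`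
(the law's body, `m ≤ k`), `levelSepPP_body_cubeLamB`.  §3 ★ `levelSepP_cubeLamB : LevelSepP L m (cubeFam false L a M ρ k) (cubeLamB L a M ρ k) 1` — v1.0's
law BY NAME at the typed inner class (the `hlaw` of `avgAtP_withQQ ∕ avgAt_withQQ` at the members with `i.Λb = cubeLamB …`).  §4 EDITION P BY NAME:
★★ `levelSepPP_cubeLamBP' : LevelSepPP L m (cubeFam false L a M ρ k) (cubeLamBP' L a M ρ k) 1` (`m ≤ k`), `levelSepPP_cubeLamB`, ★★ `levelSepPP_of_subset_trunc`
(ANY class map inside `cubeLamBP'` up to `k` and empty above obeys the law at EVERY `m`), ★★★ `levelSepPP_cubeLamBP'_trunc` ∕ `levelSepPP_cubeLamBP'_trunc'`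
(the truncated map in the two spellings `fun m j => if m ≤ k then cubeLamBP' … m j else ∅` ∕ `fun m => if m ≤ k then cubeLamBP' … m else fun _ => ∅`, EVERY `m`),
and the MEMBER presentations `…_of_eq` (`i : ZdIdx d L`, `i.Ω = cubeFam false L a M ρ i.k` — the cube sub-family's consumer index, e.g.
`B8Prop6CubeMemberOfThm33Gamma.prop6Printed_zdCub_of_thm33γ₃`'s `J′`).  §5 SCOPE CERTIFICATE `not_levelSepPP_cubeLamBP'_of_ge`: the untruncated law is
FALSE at the cube class for every `m ≥ k + 2` (kernel witness).
REUSED BY NAME: `B8IdxB8LawsB.under_or_of_bondBox` (module `B8TowerBondsNonempty`), `B8Ineq166Univ.flm_under_of_under`, `B8CubeMemberZd.under_smul_iff ∕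
smul_mem_bondBox`, `B8Eq131Cubes.mem_cube_iff ∕ cube_anti`, `B8Eq131CubesAdmissible.smul_mem_cube_succ_iff ∕ add_mem_cube_of_mem_succ ∕ cubeFam_false_of_le ∕
cubeFam_of_lt`, `B8Ineq159FlatCubeMemberPrinted.cubeLamBP_box_subset_pred ∕ cubeLamB_subset_cubeLamBP`, `B9SupplySockB9P3ZdGamma.cubeLamBP'_zero ∕ _of_ne_zero`,
`B9Eq316AveragingTransposeZd.LevelSepP`, `B9Eq316AveragingTransposeZdPrinted.LevelSepPP`.

HONEST FRAMING.  Lattice geometry of the cube tower `{□_j}_{j=0}^{k}` of (1.131) — which domains `□_{i'}` a unit bond at a box site of a class bond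
can touch; NOTHING of Bałaban's estimates is proved here; count-neutral; N05 ∕ N06 NOT discharged by this file; one finite 𝕋⁴ programme at fixed
`ε = L^{−K}`, Bałaban AS PRINTED — nothing continuum ∕ ℝ⁴ ∕ OS ∕ mass-gap ∕ Clay.  No `sorry`, no `instance`, no `notation`; standard axioms.
-/

namespace Literature.MathematicalPhysics.QuantumFieldTheory.Balaban1983to89.B8CubeMemberLevelSep

open B7Prop1Explicit B7Prop1Local B8Ineq130
open B8Ineq132 (Under BondTouches)
open B8Eq131Cubes (cube sqLo sqHi inLo inHi flm mem_cube_iff cube_anti)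
open B8Eq131CubesAdmissible (cubeFam cubeFam_false_of_le smul_mem_cube_succ_iff add_mem_cube_of_mem_succ)
open B8Ineq166Univ (flm_under_of_under)
open B8IdxB8LawsB (under_or_of_bondBox)
open B8CubeMemberZd (cubeLamB under_smul_iff)
open B8Ineq159FlatCubeMemberPrinted (cubeLamBP cubeLamBP_box_subset_pred cubeLamB_subset_cubeLamBP)
open B9SupplySockB9P3ZdGamma (cubeLamBP' cubeLamBP'_zero cubeLamBP'_of_ne_zero)
open B9Eq316AveragingTransposeZd (LevelSepP)
open B9Eq316AveragingTransposeZdPrinted (LevelSepPP)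
open B8LeafModelZd (ZdIdx)

-- `Site` alone could resolve to the torus sites of `Setup.lean`; re-export the `ℤ^d` sites of `B7Prop1Explicit`.
export B7Prop1Explicit (Site)

variable {d : ℕ}

/-! ## §1 Block geometry of the cube tower -/

/-- The coarse site of a block is determined by any of its fine sites: `x ∈ Bᵐ(z) ⇒ ⌊x ∕ Lᵐ⌋ = z` (plumbing; the private lemma of
`B8Eq131CubesAdmissible` ∕ `B8CubeMemberZd`, restated privately). [folklore] -/
private theorem flm_eq_of_under {L : ℕ} (hL : 1 ≤ L) {m : ℕ} {z x : Site d} (hx : Under L m z x) : flm L m x = z := by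
  funext i
  obtain ⟨h1, h2⟩ := hx i
  have hpos : (0 : ℤ) < (L : ℤ) ^ m := pow_pos (by exact_mod_cast hL) m
  simp only [flm]
  have hlo : z i ≤ x i / (L : ℤ) ^ m := Int.le_ediv_of_mul_le hpos (by linarith)
  have hhi : x i / (L : ℤ) ^ m < z i + 1 := Int.ediv_lt_of_lt_mul hpos (by linarith)
  omega

/-- ★ **A LEVEL-`j` BLOCK MEETING `□_{j+1}` IS A BLOCK OF `□_{j+1}^{(j)}`** (`j < k`, `L ≥ 1`): «for every `j` the cube `□_j` is a sum of the big blocks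
of the lattice `T_{L^{−j}}`» — so `□_{j+1}` is a union of `L^{j+1}`-blocks, hence of `Lʲ`-blocks, and if a fine site `y ∈ Bʲ(z)` lies in `□_{j+1}`
then the whole block does: `z ∈ □_{j+1}^{(j)} = [inLo j, inHi j]`. [cite: Balaban1985RegularSpaces, p.98 («for every j the cube □_j is a sum of the big blocks of the lattice T_{L^{-j}}»), (1.131) p.99, (1.6) p.77] -/
theorem inBox_inner_of_mem_cube_succ_of_under {L : ℕ} (hL : 1 ≤ L) (a : Site d) (M ρ : ℕ) {k j : ℕ} (hj : j < k) {z y : Site d}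
    (hzy : Under L j z y) (hy : y ∈ cube L a M ρ k (j + 1)) : InBox (inLo L a ρ k j) (inHi L a M ρ k j) z := by
  obtain ⟨w, hw, hwy⟩ := (mem_cube_iff hL).1 hy
  -- the level-`(j+1)` block of `y` contains the level-`j` block of `y`, whose coarse site is `z`
  have h1 : Under L 1 w z := by
    have h := flm_under_of_under hL (j := j + 1) (m := j) (by omega) hwy
    rwa [Nat.add_sub_cancel_left, flm_eq_of_under hL hzy] at h
  have hmem : ((L : ℤ) ^ j) • z ∈ cube L a M ρ k (j + 1) := by
    refine (mem_cube_iff hL).2 ⟨w, hw, ?_⟩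
    have h := (under_smul_iff hL 1 j w z).2 h1
    rwa [Nat.add_comm] at h
  exact (smul_mem_cube_succ_iff hL a M ρ hj z).1 hmem

/-- **THE COLLAR STEP**: a unit-lattice neighbour `y` of a `□_{n+1}`-site `y + t`, `|t|_∞ ≤ 1`, lies in `□_n` (`n < k`, `ρ ≥ 1`, `L ≥ 1`: the boundaries of
`□_n ⊃ □_{n+1}` are `ρ·Lⁿ ≥ 1` fine sites apart, `B8Eq131CubesAdmissible.add_mem_cube_of_mem_succ`). [cite: Balaban1985RegularSpaces, p.98 («□_j ⊃ □_{j+1} and a distance between boundaries of these cubes is equal to R₁M₁Lʲη»)] -/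
theorem mem_cube_of_add_unit_mem_cube_succ {L : ℕ} (hL : 1 ≤ L) (a : Site d) (M : ℕ) {ρ : ℕ} (hρ : 1 ≤ ρ) {k n : ℕ} (hn : n < k)
    {y t : Site d} (ht : ∀ i, |t i| ≤ 1) (hy : y + t ∈ cube L a M ρ k (n + 1)) : y ∈ cube L a M ρ k n := by
  have h1 : 1 ≤ ρ * L ^ n := Nat.mul_pos (by omega) (pow_pos (by omega) n)
  have h := add_mem_cube_of_mem_succ hn hy (t := -t) (fun i => ?_)
  · rwa [add_neg_cancel_right] at h
  · rw [Pi.neg_apply, abs_neg]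
    exact (ht i).trans (by exact_mod_cast h1)

/-! ## §2 The split class `cubeLamBP'` of the cube member: clause 1 (box `⊂ □_{j−1}`) and clause 2 (collar `s = 1`) -/

/-- Below the truncation level NEITHER END of a bond of the split class lies in `□_{j+1}^{(j)} = [inLo j, inHi j]` (`j < m ≤ k`, `L ≥ 1`; at level
`0` via `cubeLamB ⊆ cubeLamBP`). [cite: Balaban1984PropagatorsII, (2.3) p.224; Balaban1985RegularSpaces, (1.31) p.82, (1.68) p.88, (1.131) p.99] -/
theorem not_inBox_inner_of_mem_cubeLamBP' {L : ℕ} (hL : 1 ≤ L) (a : Site d) (M ρ : ℕ) {k m j : ℕ} (hmk : m ≤ k) (hjm : j < m)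
    {c : Site d × Fin d} (hc : c ∈ cubeLamBP' L a M ρ k m j) :
    ¬ InBox (inLo L a ρ k j) (inHi L a M ρ k j) c.1 ∧ ¬ InBox (inLo L a ρ k j) (inHi L a M ρ k j) (c.1 + e c.2) := by
  have hc' : c ∈ cubeLamBP L a M ρ k m j := by
    rcases Nat.eq_zero_or_pos j with rfl | hj
    · rw [cubeLamBP'_zero] at hc
      exact cubeLamB_subset_cubeLamBP hL a M ρ hjm.le hmk hc
    · rwa [cubeLamBP'_of_ne_zero L a M ρ k m (Nat.pos_iff_ne_zero.mp hj)] at hc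
  exact hc'.2.2 hjm

/-- ★ **FOR `j < m` THE BOX SITES OF A LEVEL-`j` BOND OF THE SPLIT CLASS AVOID `□_{j+1}`** (`m ≤ k`, `L ≥ 1`): a box site lies in the block under an end
of the bond (`B8IdxB8LawsB.under_or_of_bondBox`), and a level-`j` block meeting `□_{j+1}` would make that end a site of `□_{j+1}^{(j)}` (§1) —
excluded below the truncation level. [cite: Balaban1985RegularSpaces, (1.31) p.82, (1.68) p.88, p.98; Balaban1984PropagatorsII, (2.3) p.224] -/
theorem not_mem_cube_succ_of_mem_box_cubeLamBP' {L : ℕ} (hL : 1 ≤ L) (a : Site d) (M ρ : ℕ) {k m j : ℕ} (hmk : m ≤ k) (hjm : j < m)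
    {c : Site d × Fin d} (hc : c ∈ cubeLamBP' L a M ρ k m j) {y : Site d} (hy : InBox (loK L j c.1) (bondHiK L j c.1 c.2) y) :
    y ∉ cube L a M ρ k (j + 1) := by
  intro hy1
  have hjk : j < k := lt_of_lt_of_le hjm hmk
  obtain ⟨h1, h2⟩ := not_inBox_inner_of_mem_cubeLamBP' hL a M ρ hmk hjm hc
  rcases under_or_of_bondBox j c.1 c.2 hy with h | h
  · exact h1 (inBox_inner_of_mem_cube_succ_of_under hL a M ρ hjk h hy1)
  · exact h2 (inBox_inner_of_mem_cube_succ_of_under hL a M ρ hjk h hy1)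

/-- The inner class is part of the split class at every level (`j ≤ m ≤ k`, `L ≥ 1`): equal at level `0` (`cubeLamBP'_zero`), `cubeLamB ⊆ cubeLamBP`
above (`cubeLamB_subset_cubeLamBP`). [cite: Balaban1985RegularSpaces, (1.31) p.82; Balaban1984PropagatorsII, (2.3) p.224] -/
theorem cubeLamB_subset_cubeLamBP' {L : ℕ} (hL : 1 ≤ L) (a : Site d) (M ρ : ℕ) {k m j : ℕ} (hjm : j ≤ m) (hmk : m ≤ k) :
    cubeLamB L a M ρ k m j ⊆ cubeLamBP' L a M ρ k m j := by
  rcases Nat.eq_zero_or_pos j with rfl | hj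
  · rw [cubeLamBP'_zero]
  · rw [cubeLamBP'_of_ne_zero L a M ρ k m (Nat.pos_iff_ne_zero.mp hj)]
    exact cubeLamB_subset_cubeLamBP hL a M ρ hjm hmk

/-- **CLAUSE 1: THE BOX OF A LEVEL-`j` BOND OF THE SPLIT CLASS LIES IN `Ω_{j−1} = □_{j−1}`** (`j ≤ m ≤ k`, `1 ≤ L ≤ ρ`): at `j ≥ 1` print's class —
`cubeLamBP_box_subset_pred` BY NAME ((1.31): «all sites of the contours Γ_{b₋,x} belong to Λ_{j−1}», the collar width `ρ·L^{j−1} ≥ Lʲ`); at `j = 0`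
the inner class, whose boxes lie in `□₀ = Ω_{0−1}` by its defining law. [cite: Balaban1985RegularSpaces, (1.31) p.82, (1.131) p.99, p.98; Balaban1984PropagatorsII, (2.3) p.224] -/
theorem box_mem_pred_of_mem_cubeLamBP' {L : ℕ} (hL : 1 ≤ L) (a : Site d) (M : ℕ) {ρ : ℕ} (hρ : L ≤ ρ) {k m j : ℕ} (hmk : m ≤ k)
    (hjm : j ≤ m) {c : Site d × Fin d} (hc : c ∈ cubeLamBP' L a M ρ k m j) {y : Site d}
    (hy : InBox (loK L j c.1) (bondHiK L j c.1 c.2) y) : y ∈ cubeFam false L a M ρ k (j - 1) := by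
  rcases Nat.eq_zero_or_pos j with rfl | hj
  · rw [cubeLamBP'_zero] at hc
    show y ∈ cubeFam false L a M ρ k 0
    exact hc.1 y hy
  · rw [cubeLamBP'_of_ne_zero L a M ρ k m (Nat.pos_iff_ne_zero.mp hj)] at hc
    rw [cubeFam_false_of_le L a M ρ (by omega : j - 1 ≤ k)]
    exact cubeLamBP_box_subset_pred hL a M hρ hj hmk hc y hy

/-- ★ **CLAUSE 2, COLLAR `s = 1`: A UNIT BOND AT A BOX SITE OF A LEVEL-`j` BOND OF THE SPLIT CLASS TOUCHES `Ω_{i'} = □_{i'}` (`i' ≤ m`) ONLY FOR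
`i' ≤ j + 1`** (`j ≤ m ≤ k`, `1 ≤ L ≤ ρ`): for `j = m` trivially; for `j < m` the box site is off `□_{j+1}`, so off `□_{i'}` for `i' ≥ j + 1`, hence the unit
bond touches `□_{i'}` through its far end only — and the collar `ρ·L^{j+1} ≥ 1` between `∂□_{j+1}` and `□_{j+2}` forbids `i' ≥ j + 2`.
[cite: Balaban1985RegularSpaces, (1.28)–(1.31) pp.81–82, p.98 («a distance between boundaries of these cubes is equal to R₁M₁Lʲη»), (1.68) p.88; Balaban1984PropagatorsII, (2.1)–(2.3) p.224] -/
theorem le_succ_of_bondTouches_box_cubeLamBP' {L : ℕ} (hL : 1 ≤ L) (a : Site d) (M : ℕ) {ρ : ℕ} (hρ : L ≤ ρ) {k m j : ℕ} (hmk : m ≤ k)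
    (hjm : j ≤ m) {c : Site d × Fin d} (hc : c ∈ cubeLamBP' L a M ρ k m j) {y : Site d}
    (hy : InBox (loK L j c.1) (bondHiK L j c.1 c.2) y) {i' : ℕ} (hi' : i' ≤ m) (μ : Fin d)
    (ht : BondTouches (cubeFam false L a M ρ k i') y μ) : i' ≤ j + 1 := by
  by_contra hlt
  have hjm' : j < m := by omega
  have hi'k : i' ≤ k := hi'.trans hmk
  rw [cubeFam_false_of_le L a M ρ hi'k] at ht
  have hy1 : y ∉ cube L a M ρ k (j + 1) := not_mem_cube_succ_of_mem_box_cubeLamBP' hL a M ρ hmk hjm' hc hy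
  have hsub1 : cube L a M ρ k i' ⊆ cube L a M ρ k (j + 1) := cube_anti (by omega) hi'k
  have hsub2 : cube L a M ρ k i' ⊆ cube L a M ρ k (j + 1 + 1) := cube_anti (by omega) hi'k
  rcases ht with h | h
  · exact hy1 (hsub1 h)
  · refine hy1 (mem_cube_of_add_unit_mem_cube_succ hL a M (hL.trans hρ) (by omega : j + 1 < k) (t := e μ) (fun i => ?_) (hsub2 h))
    simp only [e, Pi.single_apply]
    split_ifs <;> simp

/-- ★ **THE BODY OF THE EDITION-P LAW AT THE CUBE MEMBER, COLLAR `s = 1`** (every truncation `m ≤ k`; `1 ≤ L ≤ ρ`): every site `y` of the box of a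
level-`j` bond of print's split class (`j ≤ m`) lies in `Ω_{j−1}`, and a unit bond at `y` touches `Ω_{i'}` (`i' ≤ m`) only for `i' ≤ j + 1` — clauses 1 and 2
assembled; `LevelSepPP L m (cubeFam …) (cubeLamBP' …) 1` unfolds to exactly this (§4 `levelSepPP_cubeLamBP'`).  FALSE for `m ≥ k + 2` (§5).
[cite: Balaban1985RegularSpaces, (1.5) p.77, (1.28)–(1.31) pp.81–82, (1.68) p.88, (1.131) p.99, p.98; Balaban1984PropagatorsII, (2.1)–(2.3) p.224] -/
theorem levelSepPP_body_cubeLamBP' {L : ℕ} (hL : 1 ≤ L) (a : Site d) (M : ℕ) {ρ : ℕ} (hρ : L ≤ ρ) {k m : ℕ} (hmk : m ≤ k) :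
    ∀ j, j ≤ m → ∀ c ∈ cubeLamBP' L a M ρ k m j, ∀ y, InBox (loK L j c.1) (bondHiK L j c.1 c.2) y →
      y ∈ cubeFam false L a M ρ k (j - 1) ∧
        ∀ i', i' ≤ m → ∀ μ : Fin d, BondTouches (cubeFam false L a M ρ k i') y μ → i' ≤ j + 1 :=
  fun _ hjm _ hc _ hy =>
    ⟨box_mem_pred_of_mem_cubeLamBP' hL a M hρ hmk hjm hc hy,
      fun _ hi' μ ht => le_succ_of_bondTouches_box_cubeLamBP' hL a M hρ hmk hjm hc hy hi' μ ht⟩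

/-- The edition-P body at the typed INNER class `cubeLamB` as well (it is part of the split class). [cite: Balaban1985RegularSpaces, (1.5) p.77, (1.31) p.82; Balaban1984PropagatorsII, (2.3) p.224] -/
theorem levelSepPP_body_cubeLamB {L : ℕ} (hL : 1 ≤ L) (a : Site d) (M : ℕ) {ρ : ℕ} (hρ : L ≤ ρ) {k m : ℕ} (hmk : m ≤ k) :
    ∀ j, j ≤ m → ∀ c ∈ cubeLamB L a M ρ k m j, ∀ y, InBox (loK L j c.1) (bondHiK L j c.1 c.2) y →
      y ∈ cubeFam false L a M ρ k (j - 1) ∧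
        ∀ i', i' ≤ m → ∀ μ : Fin d, BondTouches (cubeFam false L a M ρ k i') y μ → i' ≤ j + 1 :=
  fun j hjm c hc y hy => levelSepPP_body_cubeLamBP' hL a M hρ hmk j hjm c (cubeLamB_subset_cubeLamBP' hL a M ρ hjm hmk hc) y hy

/-! ## §3 v1.0's law `LevelSepP` («box ⊂ Ω_j», collar `1`) at the typed inner class `cubeLamB`, BY NAME -/

/-- ★ **v1.0's CLASS LAW AT THE TYPED INNER CLASS, BY NAME: `LevelSepP L m (cubeFam false L a M ρ k) (cubeLamB L a M ρ k) 1`** (every truncation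
`m ≤ k`; `1 ≤ L ≤ ρ`): clause 1 «box ⊂ Ω_j» is the class's defining box law (`B8CubeMemberZd.hbox_cubeLamB`); clause 2 is the split class's (the inner
class is part of it).  The `hlaw` of `B9Eq316AveragingTransposeZd.avgAtP_withQQ ∕ avgAt_withQQ` at the members with `i.Ω = cubeFam …`, `i.Λb = cubeLamB …`.
[cite: Balaban1985RegularSpaces, (1.5) p.77, (1.28)–(1.31) pp.81–82, (1.68) p.88, (1.131) p.99; Balaban1984PropagatorsII, (2.1)–(2.3) p.224] -/
theorem levelSepP_cubeLamB {L : ℕ} (hL : 1 ≤ L) (a : Site d) (M : ℕ) {ρ : ℕ} (hρ : L ≤ ρ) {k m : ℕ} (hmk : m ≤ k) :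
    LevelSepP L m (cubeFam false L a M ρ k) (cubeLamB L a M ρ k) 1 :=
  fun _ hjm _ hc y hy =>
    ⟨hc.1 y hy, fun _ hi' μ ht =>
      le_succ_of_bondTouches_box_cubeLamBP' hL a M hρ hmk hjm (cubeLamB_subset_cubeLamBP' hL a M ρ hjm hmk hc) hy hi' μ ht⟩

/-! ## §4 Edition P's law `LevelSepPP` BY NAME: the split class (`m ≤ k`), the TRUNCATED class map (every `m`), member presentations -/

/-- ★★ **EDITION P's CLASS LAW AT PRINT'S SPLIT CLASS OF THE CUBE MEMBER, BY NAME: `LevelSepPP L m (cubeFam false L a M ρ k) (cubeLamBP' L a M ρ k) 1`**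
(every truncation `m ≤ k`; `1 ≤ L ≤ ρ`) — the `hlaw` of `B9Eq316AveragingTransposeZdPrinted.avgAtP_withQQP ∕ avgAtγ_withQQP` at `ΛbP := cubeLamBP' …`.
[cite: Balaban1985RegularSpaces, (1.5) p.77, (1.28)–(1.31) pp.81–82, (1.68) p.88, (1.131) p.99, p.98; Balaban1984PropagatorsII, (2.1)–(2.3) p.224] -/
theorem levelSepPP_cubeLamBP' {L : ℕ} (hL : 1 ≤ L) (a : Site d) (M : ℕ) {ρ : ℕ} (hρ : L ≤ ρ) {k m : ℕ} (hmk : m ≤ k) :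
    LevelSepPP L m (cubeFam false L a M ρ k) (cubeLamBP' L a M ρ k) 1 :=
  levelSepPP_body_cubeLamBP' hL a M hρ hmk

/-- Edition P's law at the typed INNER class as well (`m ≤ k`). [cite: Balaban1985RegularSpaces, (1.5) p.77, (1.31) p.82; Balaban1984PropagatorsII, (2.3) p.224] -/
theorem levelSepPP_cubeLamB {L : ℕ} (hL : 1 ≤ L) (a : Site d) (M : ℕ) {ρ : ℕ} (hρ : L ≤ ρ) {k m : ℕ} (hmk : m ≤ k) :
    LevelSepPP L m (cubeFam false L a M ρ k) (cubeLamB L a M ρ k) 1 :=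
  levelSepPP_body_cubeLamB hL a M hρ hmk

/-- ★★ **ANY CLASS MAP INSIDE THE SPLIT CLASS UP TO `k` AND EMPTY ABOVE `k` OBEYS EDITION P's LAW AT EVERY `m`** (`1 ≤ L ≤ ρ`): below `k` the law is
inherited from `cubeLamBP'` (it is antitone in the class), above `k` it is vacuous.  The shape-free form of the truncation cure.
[cite: Balaban1985RegularSpaces, (1.31) p.82, (1.68) p.88, (1.131) p.99; Balaban1984PropagatorsII, (2.3) p.224] -/
theorem levelSepPP_of_subset_trunc {L : ℕ} (hL : 1 ≤ L) (a : Site d) (M : ℕ) {ρ : ℕ} (hρ : L ≤ ρ) (k : ℕ)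
    (ΛbT : ℕ → ℕ → Set (Site d × Fin d)) (hle : ∀ m, m ≤ k → ∀ j, j ≤ m → ΛbT m j ⊆ cubeLamBP' L a M ρ k m j)
    (hgt : ∀ m, k < m → ∀ j, j ≤ m → ΛbT m j = ∅) (m : ℕ) :
    LevelSepPP L m (cubeFam false L a M ρ k) ΛbT 1 := by
  intro j hjm c hc y hy
  rcases Nat.lt_or_ge k m with hkm | hmk
  · rw [hgt m hkm j hjm] at hc
    exact absurd hc (Set.notMem_empty c)
  · exact levelSepPP_body_cubeLamBP' hL a M hρ hmk j hjm c (hle m hmk j hjm hc) y hy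

/-- ★★★ **THE TRUNCATED SPLIT CLASS OBEYS EDITION P's LAW AT EVERY `m`** — spelling `fun m j => if m ≤ k then cubeLamBP' … m j else ∅` (`1 ≤ L ≤ ρ`).  With
`ops := withQQP τ L ΛbT ops₀` this is the `hlaw` of `avgAtγ_withQQP … m` for EVERY `m`, i.e. the unguarded binder `havg : ∀ M j m, AvgAtγ …`; at `m ≤ k`
the sockets read `ΛbT m = cubeLamBP' … m` (`if_pos`). [cite: Balaban1985RegularSpaces, (1.31) p.82, (1.68) p.88, (1.131) p.99; Balaban1984PropagatorsII, (2.3) p.224] -/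
theorem levelSepPP_cubeLamBP'_trunc {L : ℕ} (hL : 1 ≤ L) (a : Site d) (M : ℕ) {ρ : ℕ} (hρ : L ≤ ρ) (k m : ℕ) :
    LevelSepPP L m (cubeFam false L a M ρ k) (fun m' j => if m' ≤ k then cubeLamBP' L a M ρ k m' j else ∅) 1 := by
  refine levelSepPP_of_subset_trunc hL a M hρ k _ (fun m' hm' j _ c hc => ?_) (fun m' hm' j _ => ?_) m
  · rwa [if_pos hm'] at hc
  · rw [if_neg (not_le.mpr hm')]

/-- ★★★ **THE TRUNCATED SPLIT CLASS OBEYS EDITION P's LAW AT EVERY `m`** — spelling `fun m => if m ≤ k then cubeLamBP' … m else fun _ => ∅` (dag-n06-b's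
`ΛbT`; `1 ≤ L ≤ ρ`). [cite: Balaban1985RegularSpaces, (1.31) p.82, (1.68) p.88, (1.131) p.99; Balaban1984PropagatorsII, (2.3) p.224] -/
theorem levelSepPP_cubeLamBP'_trunc' {L : ℕ} (hL : 1 ≤ L) (a : Site d) (M : ℕ) {ρ : ℕ} (hρ : L ≤ ρ) (k m : ℕ) :
    LevelSepPP L m (cubeFam false L a M ρ k) (fun m' => if m' ≤ k then cubeLamBP' L a M ρ k m' else fun _ => ∅) 1 := by
  refine levelSepPP_of_subset_trunc hL a M hρ k _ (fun m' hm' j _ c hc => ?_) (fun m' hm' j _ => ?_) m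
  · rwa [if_pos hm'] at hc
  · rw [if_neg (not_le.mpr hm')]

/-- ★ **MEMBER PRESENTATION** (the cube sub-family's consumer index: a member `i : ZdIdx d L` whose domains ARE the cube tower, `i.Ω = cubeFam false L a M ρ i.k`):
edition P's law at the split class for every `m ≤ i.k`. [cite: Balaban1985RegularSpaces, (1.31) p.82, (1.131) p.99; Balaban1984PropagatorsII, (2.3) p.224] -/
theorem levelSepPP_cubeLamBP'_of_eq {L : ℕ} (hL : 1 ≤ L) (i : ZdIdx d L) (a : Site d) (M : ℕ) {ρ : ℕ} (hρ : L ≤ ρ)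
    (hΩ : i.Ω = cubeFam false L a M ρ i.k) {m : ℕ} (hmk : m ≤ i.k) :
    LevelSepPP L m i.Ω (cubeLamBP' L a M ρ i.k) 1 := by
  rw [hΩ]
  exact levelSepPP_body_cubeLamBP' hL a M hρ hmk

/-- ★ **MEMBER PRESENTATION, TRUNCATED CLASS MAP, EVERY `m`** (spelling `fun m j => if m ≤ i.k then … else ∅`). [cite: Balaban1985RegularSpaces, (1.31) p.82, (1.68) p.88, (1.131) p.99; Balaban1984PropagatorsII, (2.3) p.224] -/
theorem levelSepPP_cubeLamBP'_trunc_of_eq {L : ℕ} (hL : 1 ≤ L) (i : ZdIdx d L) (a : Site d) (M : ℕ) {ρ : ℕ} (hρ : L ≤ ρ)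
    (hΩ : i.Ω = cubeFam false L a M ρ i.k) (m : ℕ) :
    LevelSepPP L m i.Ω (fun m' j => if m' ≤ i.k then cubeLamBP' L a M ρ i.k m' j else ∅) 1 := by
  rw [hΩ]
  exact levelSepPP_cubeLamBP'_trunc hL a M hρ i.k m

/-- ★ **MEMBER PRESENTATION, TRUNCATED CLASS MAP, EVERY `m`** (dag-n06-b's spelling `fun m => if m ≤ i.k then … else fun _ => ∅`). [cite: Balaban1985RegularSpaces, (1.31) p.82, (1.68) p.88, (1.131) p.99; Balaban1984PropagatorsII, (2.3) p.224] -/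
theorem levelSepPP_cubeLamBP'_trunc'_of_eq {L : ℕ} (hL : 1 ≤ L) (i : ZdIdx d L) (a : Site d) (M : ℕ) {ρ : ℕ} (hρ : L ≤ ρ)
    (hΩ : i.Ω = cubeFam false L a M ρ i.k) (m : ℕ) :
    LevelSepPP L m i.Ω (fun m' => if m' ≤ i.k then cubeLamBP' L a M ρ i.k m' else fun _ => ∅) 1 := by
  rw [hΩ]
  exact levelSepPP_cubeLamBP'_trunc' hL a M hρ i.k m

/-- v1.0's law at the inner class in the member presentation (`i.Ω = cubeFam …`, `m ≤ i.k`). [cite: Balaban1985RegularSpaces, (1.5) p.77, (1.31) p.82; Balaban1984PropagatorsII, (2.3) p.224] -/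
theorem levelSepP_cubeLamB_of_eq {L : ℕ} (hL : 1 ≤ L) (i : ZdIdx d L) (a : Site d) (M : ℕ) {ρ : ℕ} (hρ : L ≤ ρ)
    (hΩ : i.Ω = cubeFam false L a M ρ i.k) {m : ℕ} (hmk : m ≤ i.k) :
    LevelSepP L m i.Ω (cubeLamB L a M ρ i.k) 1 := by
  rw [hΩ]
  exact levelSepP_cubeLamB hL a M hρ hmk

/-! ## §5 The scope certificate: the untruncated law is FALSE AS TYPED above the tower (`m ≥ k + 2`) -/

/-- **SCOPE CERTIFICATE (LOCATED): THE UNTRUNCATED EDITION-P LAW AT THE CUBE CLASS FAILS FOR `m ≥ k + 2`** (`d ≥ 1`, `L ≥ 1`, `ρ ≥ 1`; any `a`, `M`, `k`).  At the junk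
level `j = k + 2` (`k − j = 0` in `sqLo ∕ sqHi ∕ inLo ∕ inHi`) the class `cubeLamBP … k m (k+2)` contains the bond `⟨a − ρ𝟙 − e_μ, a − ρ𝟙⟩` (an end on the
`ρ`-collar ring of `[a − ρ, a + M − 1 + ρ]^d`, no end in `[a, a + M − 1]^d`), whose box corner `L^{k+2}·(a − ρ𝟙 − e_μ)` clause 1 would place in
`cubeFam … (k + 1) = ∅`.  Hence the TRUNCATED class map of §4 (`∅` above `k`) — the cure that feeds the unguarded `∀ m` binder of
`sockB9P3D4γ_allLevels_of_thm33_on` without a binder-family edition (dag-n06-b WORD 2026-08-28 02:21Z).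
[cite: Balaban1985RegularSpaces, (1.68) p.88, (1.131) p.99, (1.3) p.77 (bookkeeping: the typed tower above level k)] -/
theorem not_levelSepPP_cubeLamBP'_of_ge (hd : 1 ≤ d) {L : ℕ} (hL : 1 ≤ L) (a : Site d) (M : ℕ) {ρ : ℕ} (hρ : 1 ≤ ρ) {k m : ℕ}
    (hm : k + 2 ≤ m) : ¬ LevelSepPP L m (cubeFam false L a M ρ k) (cubeLamBP' L a M ρ k) 1 := by
  intro h
  have hρz : (1 : ℤ) ≤ ρ := by exact_mod_cast hρ
  have hkj : k - (k + 2) = 0 := by omega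
  -- the witness bond `⟨a − ρ𝟙 − e_μ, a − ρ𝟙⟩` at the junk level `k + 2`
  let μ : Fin d := ⟨0, hd⟩
  let cm : Site d := (fun i => a i - ρ) - e μ
  have hcp : cm + e μ = fun i => a i - ρ := sub_add_cancel _ _
  have hc : (cm, μ) ∈ cubeLamBP' L a M ρ k m (k + 2) := by
    rw [cubeLamBP'_of_ne_zero L a M ρ k m (by omega : k + 2 ≠ 0)]
    refine ⟨hm, Or.inr ?_, fun _ => ⟨?_, ?_⟩⟩
    · -- the far end lies on the collar ring `[a − ρ, a + M − 1 + ρ]`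
      intro i
      simp only [hcp, sqLo, sqHi, B8Eq131Cubes.bLo, B8Eq131Cubes.bHi, hkj, B8Eq131Cubes.gs_zero, pow_zero, one_mul, mul_one]
      constructor <;> linarith
    · -- the near end is not in `[a, a + M − 1]` (coordinate `μ`)
      intro hin
      have h1 := (hin μ).1
      simp only [inLo, B8Eq131Cubes.bLo, hkj, B8Eq131Cubes.gs_zero, pow_zero, one_mul, Nat.sub_self, mul_zero,
        Nat.cast_zero, sub_zero] at h1
      have h2 : cm μ = a μ - ρ - 1 := by simp [cm, e]
      linarith
    · -- nor is the far end
      intro hin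
      have h1 := (hin μ).1
      simp only [hcp, inLo, B8Eq131Cubes.bLo, hkj, B8Eq131Cubes.gs_zero, pow_zero, one_mul, Nat.sub_self, mul_zero,
        Nat.cast_zero, sub_zero] at h1
      linarith
  -- clause 1 would put the box corner into `Ω_{k+1} = ∅`
  have hy := (h (k + 2) hm (cm, μ) hc (((L : ℤ) ^ (k + 2)) • cm) (B8CubeMemberZd.smul_mem_bondBox hL (k + 2) cm μ)).1
  rw [show k + 2 - 1 = k + 1 by omega, B8Eq131CubesAdmissible.cubeFam_of_lt false L a M ρ (Nat.lt_succ_self k)] at hy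
  exact hy

end Literature.MathematicalPhysics.QuantumFieldTheory.Balaban1983to89.B8CubeMemberLevelSep
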